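import Literature.NumberTheory.EllipticCurves.TateCurve.LaurentSeriesEval
import Literature.NumberTheory.EllipticCurves.TateCurve.Invariants
import HarnessLib

/-!
# The formal Tate series `X̃, Ỹ ∈ ℤ[u,u⁻¹]⟦q⟧` and the formal Tate relation
# (Silverman, *Advanced Topics*, proof of Thm. V.3.1 (c), PDF pp. 396–397)

Topic `Literature/NumberTheory/EllipticCurves/TateCurve`, namespace
`Literature.NumberTheory.EllipticCurves.TateCurve` (abc-iut cell, TRANCHE-T1 P21; sub-lemma U-2b
of the discharge plan of the named fact `uniformization`).

On the annulus `|q| < |u| < |q|⁻¹` Silverman expands (PDF pp. 396–397)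
`X(u,q) = u/(1−u)² + Σ_{d≥1} (Σ_{m∣d} m(uᵐ + u⁻ᵐ − 2)) q^d`,
`Y(u,q) = u²/(1−u)³ + Σ_{d≥1} (Σ_{m∣d} [C(m,2)uᵐ − C(m+1,2)u⁻ᵐ + m]) q^d` in `ℚ(u)⟦q⟧`.
We clear the denominators: `X̃ := (1−u)²X`, `Ỹ := (1−u)³Y` are elements of `ℤ[u,u⁻¹]⟦q⟧`
(`xForm`, `yForm`), as are `a₄(q) = −5Σσ₃(d)q^d` (`a4Form`) and `a₆(q) = −Σ a6Coeff(d) q^d`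
(`a6Form`, integral coefficients by `TateCurve.Invariants.a6Coeff`). The formal Tate relation is

  `tateRel := Ỹ² + (1−u)X̃Ỹ − X̃³ − (1−u)⁴a₄X̃ − (1−u)⁶a₆ = (1−u)⁶·(Y² + XY − X³ − a₄X − a₆)`.

Main results (for ANY complete normed field `𝕜`, `u ∈ 𝕜ˣ`, `‖q‖ < ‖u‖ < ‖q‖⁻¹`):
* `evSummable_xForm`/`ev_xForm` : `X̃` converges absolutely and
  `ev X̃ = u + (1−u)² Σ_d c_d(u) q^{d+1}` with `c_d` in the shape of `tateX_eq_annulus`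
  (`UniformizationAnnulus`, L2-t6); likewise `ev_yForm`, `ev_a4Form = tateA4 q`,
  `ev_a6Form = tateA6 q` (`12 ≠ 0` in `𝕜`);
* `ev_tateRel` : if `(1−u)²X = ev X̃` and `(1−u)³Y = ev Ỹ` then
  `ev tateRel = (1−u)⁶ (Y² + XY − X³ − a₄(q)X − a₆(q))`.
So the Tate equation for `(X, Y)` at `(u, q)`, `u ≠ 1`, is EQUIVALENT to `ev tateRel u q = 0`, in
`ℂ` and in `ℚ_p`-fields alike; `tateRel = 0` is then read off from the complex case
(`ComplexTateCurve`) by the identity principle (`LaurentSeriesIdentity`).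

## References
* [SilvermanATAEC1994] J. H. Silverman, *Advanced Topics in the Arithmetic of Elliptic Curves*,
  GTM 151, Springer 1994, proof of Thm. V.3.1 (c) (PDF pp. 396–397).
-/

noncomputable section

open LaurentPolynomial PowerSeries Finset
open scoped ArithmeticFunction.sigma

namespace Literature.NumberTheory.EllipticCurves.TateCurve

open SteinWuthrich2013

/-! ### The formal series -/

/-- The coefficient `Σ_{m ∣ d+1} m (uᵐ + u⁻ᵐ − 2) ∈ ℤ[u,u⁻¹]` of `q^{d+1}` in `X(u,q)` (p. 397).
[cite: SilvermanATAEC1994, Thm. V.3.1 (c) (proof, PDF p. 397)] -/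
def xCoeffL (d : ℕ) : LaurentPolynomial ℤ :=
  ∑ m ∈ (d + 1).divisors, (m : LaurentPolynomial ℤ) * (T (m : ℤ) + T (-(m : ℤ)) - 2)

/-- The coefficient `Σ_{m ∣ d+1} [C(m,2)uᵐ − C(m+1,2)u⁻ᵐ + m] ∈ ℤ[u,u⁻¹]` of `q^{d+1}` in
`Y(u,q)` (p. 397). [cite: SilvermanATAEC1994, Thm. V.3.1 (c) (proof, PDF p. 397)] -/
def yCoeffL (d : ℕ) : LaurentPolynomial ℤ :=
  ∑ m ∈ (d + 1).divisors, (((m.choose 2 : ℕ) : LaurentPolynomial ℤ) * T (m : ℤ)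
    - (((m + 1).choose 2 : ℕ) : LaurentPolynomial ℤ) * T (-(m : ℤ)) + (m : LaurentPolynomial ℤ))

/-- `X̃ = (1−u)² X(u,q) = u + (1−u)² Σ_{d≥1} c_d(u) q^d ∈ ℤ[u,u⁻¹]⟦q⟧`.
[cite: SilvermanATAEC1994, Thm. V.3.1 (c) (proof, PDF p. 397)] -/
def xForm : LaurentQSeries :=
  PowerSeries.mk fun d ↦ if d = 0 then T 1 else (1 - T 1) ^ 2 * xCoeffL (d - 1)

/-- `Ỹ = (1−u)³ Y(u,q) = u² + (1−u)³ Σ_{d≥1} c'_d(u) q^d ∈ ℤ[u,u⁻¹]⟦q⟧`.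
[cite: SilvermanATAEC1994, Thm. V.3.1 (c) (proof, PDF p. 397)] -/
def yForm : LaurentQSeries :=
  PowerSeries.mk fun d ↦ if d = 0 then T 2 else (1 - T 1) ^ 3 * yCoeffL (d - 1)

/-- `a₄(q) = −5 Σ_{d≥1} σ₃(d) q^d ∈ ℤ⟦q⟧ ⊂ ℤ[u,u⁻¹]⟦q⟧`.
[cite: SilvermanATAEC1994, Thm. V.3.1 (a) (PDF p. 395)] -/
def a4Form : LaurentQSeries :=
  PowerSeries.mk fun d ↦ if d = 0 then 0 else LaurentPolynomial.C (-5 * (σ 3 d : ℤ))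

/-- `a₆(q) = −Σ_{d≥1} ((5σ₃(d) + 7σ₅(d))/12) q^d ∈ ℤ⟦q⟧ ⊂ ℤ[u,u⁻¹]⟦q⟧`.
[cite: SilvermanATAEC1994, Thm. V.3.1 (a) (PDF p. 395)] -/
def a6Form : LaurentQSeries :=
  PowerSeries.mk fun d ↦ if d = 0 then 0 else LaurentPolynomial.C (-a6Coeff d)

/-- The constant `1 − u`. [cite: SilvermanATAEC1994, Thm. V.3.1 (c) (proof, PDF p. 397)] -/
def oneSubU : LaurentQSeries := PowerSeries.C (1 - T 1)

/-- The formal Tate relation `Ỹ² + (1−u)X̃Ỹ − X̃³ − (1−u)⁴a₄X̃ − (1−u)⁶a₆ ∈ ℤ[u,u⁻¹]⟦q⟧`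
(`= (1−u)⁶ (Y² + XY − X³ − a₄X − a₆)`). [cite: SilvermanATAEC1994, Thm. V.3.1 (c) (proof, PDF p. 397)] -/
def tateRel : LaurentQSeries :=
  yForm ^ 2 + oneSubU * xForm * yForm - xForm ^ 3 - oneSubU ^ 4 * a4Form * xForm
    - oneSubU ^ 6 * a6Form

/-! ### Coefficients -/

/-- `coeff 0 X̃ = u`. [cite: SilvermanATAEC1994, Thm. V.3.1 (c) (proof, PDF p. 397)] -/
theorem coeff_xForm_zero : coeff 0 xForm = T 1 := by simp [xForm, coeff_mk]

/-- `coeff (d+1) X̃ = (1−u)² c_d(u)`. [cite: SilvermanATAEC1994, Thm. V.3.1 (c) (proof, PDF p. 397)] -/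
theorem coeff_xForm_succ (d : ℕ) : coeff (d + 1) xForm = (1 - T 1) ^ 2 * xCoeffL d := by
  simp [xForm, coeff_mk]

/-- `coeff 0 Ỹ = u²`. [cite: SilvermanATAEC1994, Thm. V.3.1 (c) (proof, PDF p. 397)] -/
theorem coeff_yForm_zero : coeff 0 yForm = T 2 := by simp [yForm, coeff_mk]

/-- `coeff (d+1) Ỹ = (1−u)³ c'_d(u)`. [cite: SilvermanATAEC1994, Thm. V.3.1 (c) (proof, PDF p. 397)] -/
theorem coeff_yForm_succ (d : ℕ) : coeff (d + 1) yForm = (1 - T 1) ^ 3 * yCoeffL d := by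
  simp [yForm, coeff_mk]

/-- `coeff 0 a₄ = 0`. [cite: SilvermanATAEC1994, Thm. V.3.1 (a) (PDF p. 395)] -/
theorem coeff_a4Form_zero : coeff 0 a4Form = 0 := by simp [a4Form, coeff_mk]

/-- `coeff (d+1) a₄ = −5σ₃(d+1)`. [cite: SilvermanATAEC1994, Thm. V.3.1 (a) (PDF p. 395)] -/
theorem coeff_a4Form_succ (d : ℕ) : coeff (d + 1) a4Form = LaurentPolynomial.C (-5 * (σ 3 (d + 1) : ℤ)) := by
  simp [a4Form, coeff_mk]

/-- `coeff 0 a₆ = 0`. [cite: SilvermanATAEC1994, Thm. V.3.1 (a) (PDF p. 395)] -/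
theorem coeff_a6Form_zero : coeff 0 a6Form = 0 := by simp [a6Form, coeff_mk]

/-- `coeff (d+1) a₆ = −a6Coeff(d+1)`. [cite: SilvermanATAEC1994, Thm. V.3.1 (a) (PDF p. 395)] -/
theorem coeff_a6Form_succ (d : ℕ) : coeff (d + 1) a6Form = LaurentPolynomial.C (-a6Coeff (d + 1)) := by
  simp [a6Form, coeff_mk]

/-! ### Evaluation in a complete normed field -/

section Eval

variable {𝕜 : Type*} [NormedField 𝕜] (u : 𝕜ˣ) {q : 𝕜}

/-- `c_d(u)` evaluated: `Σ_{m ∣ d+1} m (uᵐ + u⁻ᵐ − 2)` (the coefficient of `tateX_eq_annulus`).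
[cite: SilvermanATAEC1994, Thm. V.3.1 (c) (proof, PDF p. 397)] -/
theorem evCoeff_xCoeffL (d : ℕ) : evCoeff u (xCoeffL d) =
    ∑ m ∈ (d + 1).divisors, ((m : ℕ) : 𝕜) * ((u : 𝕜) ^ m + (u : 𝕜)⁻¹ ^ m - 2) := by
  rw [xCoeffL, map_sum]
  refine sum_congr rfl fun m _ ↦ ?_
  rw [map_mul, map_sub, map_add, map_natCast, evCoeff_T, evCoeff_T, map_ofNat, zpow_natCast,
    zpow_neg, zpow_natCast, Units.val_pow_eq_pow_val, ← inv_pow, Units.val_pow_eq_pow_val,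
    Units.val_inv_eq_inv_val]

/-- `c'_d(u)` evaluated: `Σ_{m ∣ d+1} [C(m,2)uᵐ − C(m+1,2)u⁻ᵐ + m]` (the coefficient of
`tateY_eq_annulus`). [cite: SilvermanATAEC1994, Thm. V.3.1 (c) (proof, PDF p. 397)] -/
theorem evCoeff_yCoeffL (d : ℕ) : evCoeff u (yCoeffL d) =
    ∑ m ∈ (d + 1).divisors, ((((m.choose 2 : ℕ)) : 𝕜) * (u : 𝕜) ^ m
      - (((m + 1).choose 2 : ℕ) : 𝕜) * (u : 𝕜)⁻¹ ^ m + (m : 𝕜)) := by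
  rw [yCoeffL, map_sum]
  refine sum_congr rfl fun m _ ↦ ?_
  rw [map_add, map_sub, map_mul, map_mul, map_natCast, map_natCast, map_natCast, evCoeff_T,
    evCoeff_T, zpow_natCast, zpow_neg, zpow_natCast, Units.val_pow_eq_pow_val, ← inv_pow,
    Units.val_pow_eq_pow_val, Units.val_inv_eq_inv_val]

/-- `1 ≤ M := max ‖u‖ ‖u⁻¹‖`. [folklore] -/
private theorem one_le_max_norm : 1 ≤ max ‖(u : 𝕜)‖ ‖(u : 𝕜)⁻¹‖ := by
  refine le_of_not_gt fun h ↦ ?_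
  have h1 : ‖(u : 𝕜)‖ < 1 := lt_of_le_of_lt (le_max_left _ _) h
  have h2 : ‖(u : 𝕜)⁻¹‖ < 1 := lt_of_le_of_lt (le_max_right _ _) h
  have : ‖(u : 𝕜)‖ * ‖(u : 𝕜)⁻¹‖ < 1 := by
    calc _ < 1 * 1 := mul_lt_mul'' h1 h2 (norm_nonneg _) (norm_nonneg _)
      _ = 1 := one_mul 1
  rw [← norm_mul, mul_inv_cancel₀ u.ne_zero, norm_one] at this
  exact lt_irrefl _ this

/-- `‖u^{±m}‖ ≤ M^{d+1}` for `m ≤ d+1`. [folklore] -/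
private theorem norm_pow_le_max_pow {m d : ℕ} (hmd : m ≤ d + 1) :
    ‖(u : 𝕜) ^ m‖ ≤ max ‖(u : 𝕜)‖ ‖(u : 𝕜)⁻¹‖ ^ (d + 1) ∧
      ‖(u : 𝕜)⁻¹ ^ m‖ ≤ max ‖(u : 𝕜)‖ ‖(u : 𝕜)⁻¹‖ ^ (d + 1) := by
  have hM1 := one_le_max_norm u
  constructor
  · rw [norm_pow]
    exact (pow_le_pow_left₀ (norm_nonneg _) (le_max_left _ _) m).trans (pow_le_pow_right₀ hM1 hmd)
  · rw [norm_pow]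
    exact (pow_le_pow_left₀ (norm_nonneg _) (le_max_right _ _) m).trans (pow_le_pow_right₀ hM1 hmd)

/-- `‖(n : 𝕜)‖ ≤ n`. [folklore] -/
private theorem norm_natCast_le' (n : ℕ) : ‖(n : 𝕜)‖ ≤ n := by
  simpa using Nat.norm_cast_le (α := 𝕜) n

/-- `‖c_d(u)‖ ≤ 4 (d+1)² M^{d+1}`, `M = max ‖u‖ ‖u⁻¹‖`. [folklore] -/
private theorem norm_evCoeff_xCoeffL_le (d : ℕ) :
    ‖evCoeff u (xCoeffL d)‖ ≤ 4 * ((d + 1 : ℕ) : ℝ) ^ 2 * max ‖(u : 𝕜)‖ ‖(u : 𝕜)⁻¹‖ ^ (d + 1) := by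
  set M := max ‖(u : 𝕜)‖ ‖(u : 𝕜)⁻¹‖ with hM
  have hM1 : 1 ≤ M := one_le_max_norm u
  rw [evCoeff_xCoeffL]
  have hterm : ∀ m ∈ (d + 1).divisors,
      ‖((m : ℕ) : 𝕜) * ((u : 𝕜) ^ m + (u : 𝕜)⁻¹ ^ m - 2)‖ ≤ ((d + 1 : ℕ) : ℝ) * (4 * M ^ (d + 1)) := by
    intro m hm
    have hmd : m ≤ d + 1 := Nat.divisor_le hm
    obtain ⟨hp1, hp2⟩ := norm_pow_le_max_pow u hmd
    rw [norm_mul]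
    have hn : ‖(m : 𝕜)‖ ≤ (d + 1 : ℕ) := (norm_natCast_le' m).trans (by exact_mod_cast hmd)
    have h3 : ‖(u : 𝕜) ^ m + (u : 𝕜)⁻¹ ^ m - 2‖ ≤ 4 * M ^ (d + 1) := by
      calc _ ≤ ‖(u : 𝕜) ^ m‖ + ‖(u : 𝕜)⁻¹ ^ m‖ + ‖(2 : 𝕜)‖ :=
            norm_sub_le_of_le (norm_add_le _ _) le_rfl
        _ ≤ M ^ (d + 1) + M ^ (d + 1) + 2 := by
            gcongr
            exact norm_natCast_le' (𝕜 := 𝕜) 2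
        _ ≤ 4 * M ^ (d + 1) := by
            have : 1 ≤ M ^ (d + 1) := one_le_pow₀ hM1
            linarith
    exact mul_le_mul hn h3 (norm_nonneg _) (by positivity)
  calc ‖∑ m ∈ (d + 1).divisors, ((m : ℕ) : 𝕜) * ((u : 𝕜) ^ m + (u : 𝕜)⁻¹ ^ m - 2)‖
      ≤ ∑ m ∈ (d + 1).divisors, ((d + 1 : ℕ) : ℝ) * (4 * M ^ (d + 1)) := norm_sum_le_of_le _ hterm
    _ = ((d + 1).divisors.card : ℝ) * (((d + 1 : ℕ) : ℝ) * (4 * M ^ (d + 1))) := by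
        rw [sum_const, nsmul_eq_mul]
    _ ≤ ((d + 1 : ℕ) : ℝ) * (((d + 1 : ℕ) : ℝ) * (4 * M ^ (d + 1))) := by
        gcongr
        exact_mod_cast Nat.card_divisors_le_self (d + 1)
    _ = 4 * ((d + 1 : ℕ) : ℝ) ^ 2 * M ^ (d + 1) := by ring

/-- `C(m,2) ≤ m²` and `C(m+1,2) ≤ m²` for `1 ≤ m`. [folklore] -/
private theorem choose_two_le_sq {m : ℕ} (hm : 1 ≤ m) :
    m.choose 2 ≤ m ^ 2 ∧ (m + 1).choose 2 ≤ m ^ 2 := by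
  constructor
  · exact Nat.choose_le_pow m 2
  · rw [Nat.choose_two_right, show m + 1 - 1 = m from rfl]
    refine Nat.div_le_of_le_mul ?_
    calc (m + 1) * m ≤ (2 * m) * m := Nat.mul_le_mul_right m (by omega)
      _ = 2 * m ^ 2 := by ring

/-- `‖c'_d(u)‖ ≤ 3 (d+1)³ M^{d+1}`, `M = max ‖u‖ ‖u⁻¹‖`. [folklore] -/
private theorem norm_evCoeff_yCoeffL_le (d : ℕ) :
    ‖evCoeff u (yCoeffL d)‖ ≤ 3 * ((d + 1 : ℕ) : ℝ) ^ 3 * max ‖(u : 𝕜)‖ ‖(u : 𝕜)⁻¹‖ ^ (d + 1) := by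
  set M := max ‖(u : 𝕜)‖ ‖(u : 𝕜)⁻¹‖ with hM
  have hM1 : 1 ≤ M := one_le_max_norm u
  rw [evCoeff_yCoeffL]
  have hterm : ∀ m ∈ (d + 1).divisors,
      ‖((((m.choose 2 : ℕ)) : 𝕜) * (u : 𝕜) ^ m - (((m + 1).choose 2 : ℕ) : 𝕜) * (u : 𝕜)⁻¹ ^ m
        + (m : 𝕜))‖ ≤ 3 * (((d + 1 : ℕ) : ℝ) ^ 2 * M ^ (d + 1)) := by
    intro m hm
    have hmd : m ≤ d + 1 := Nat.divisor_le hm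
    have hm1 : 1 ≤ m := Nat.pos_of_mem_divisors hm
    obtain ⟨hp1, hp2⟩ := norm_pow_le_max_pow u hmd
    obtain ⟨hc1, hc2⟩ := choose_two_le_sq hm1
    have hsq : ((m ^ 2 : ℕ) : ℝ) ≤ ((d + 1 : ℕ) : ℝ) ^ 2 := by
      exact_mod_cast Nat.pow_le_pow_left hmd 2
    have hc1' : ‖((m.choose 2 : ℕ) : 𝕜)‖ ≤ ((d + 1 : ℕ) : ℝ) ^ 2 :=
      (norm_natCast_le' _).trans ((by exact_mod_cast hc1 : ((m.choose 2 : ℕ) : ℝ) ≤ (m ^ 2 : ℕ)).trans hsq)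
    have hc2' : ‖(((m + 1).choose 2 : ℕ) : 𝕜)‖ ≤ ((d + 1 : ℕ) : ℝ) ^ 2 :=
      (norm_natCast_le' _).trans
        ((by exact_mod_cast hc2 : (((m + 1).choose 2 : ℕ) : ℝ) ≤ (m ^ 2 : ℕ)).trans hsq)
    have hn : ‖(m : 𝕜)‖ ≤ ((d + 1 : ℕ) : ℝ) ^ 2 * M ^ (d + 1) := by
      have h1 : ‖(m : 𝕜)‖ ≤ (d + 1 : ℕ) := (norm_natCast_le' m).trans (by exact_mod_cast hmd)
      have h2 : (1 : ℝ) ≤ (d + 1 : ℕ) := by exact_mod_cast Nat.succ_le_succ (Nat.zero_le d)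
      have h3 : 1 ≤ M ^ (d + 1) := one_le_pow₀ hM1
      calc ‖(m : 𝕜)‖ ≤ (d + 1 : ℕ) := h1
        _ ≤ ((d + 1 : ℕ) : ℝ) ^ 2 * 1 := by nlinarith
        _ ≤ ((d + 1 : ℕ) : ℝ) ^ 2 * M ^ (d + 1) := by gcongr
    calc _ ≤ ‖((m.choose 2 : ℕ) : 𝕜) * (u : 𝕜) ^ m‖
          + ‖(((m + 1).choose 2 : ℕ) : 𝕜) * (u : 𝕜)⁻¹ ^ m‖ + ‖(m : 𝕜)‖ :=
          norm_add_le_of_le (norm_sub_le _ _) le_rfl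
      _ ≤ ((d + 1 : ℕ) : ℝ) ^ 2 * M ^ (d + 1) + ((d + 1 : ℕ) : ℝ) ^ 2 * M ^ (d + 1)
          + ((d + 1 : ℕ) : ℝ) ^ 2 * M ^ (d + 1) := by
          rw [norm_mul, norm_mul]
          gcongr
      _ = 3 * (((d + 1 : ℕ) : ℝ) ^ 2 * M ^ (d + 1)) := by ring
  calc ‖∑ m ∈ (d + 1).divisors, ((((m.choose 2 : ℕ)) : 𝕜) * (u : 𝕜) ^ m
        - (((m + 1).choose 2 : ℕ) : 𝕜) * (u : 𝕜)⁻¹ ^ m + (m : 𝕜))‖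
      ≤ ∑ m ∈ (d + 1).divisors, 3 * (((d + 1 : ℕ) : ℝ) ^ 2 * M ^ (d + 1)) :=
        norm_sum_le_of_le _ hterm
    _ = ((d + 1).divisors.card : ℝ) * (3 * (((d + 1 : ℕ) : ℝ) ^ 2 * M ^ (d + 1))) := by
        rw [sum_const, nsmul_eq_mul]
    _ ≤ ((d + 1 : ℕ) : ℝ) * (3 * (((d + 1 : ℕ) : ℝ) ^ 2 * M ^ (d + 1))) := by
        gcongr
        exact_mod_cast Nat.card_divisors_le_self (d + 1)
    _ = 3 * ((d + 1 : ℕ) : ℝ) ^ 3 * M ^ (d + 1) := by ring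

/-- On the annulus `‖q‖ < ‖u‖ < ‖q‖⁻¹` one has `M ‖q‖ < 1` for `M = max ‖u‖ ‖u⁻¹‖`. [folklore] -/
private theorem max_mul_norm_lt_one (hqu : ‖q‖ < ‖(u : 𝕜)‖) (huq : ‖(u : 𝕜)‖ < ‖q‖⁻¹) :
    max ‖(u : 𝕜)‖ ‖(u : 𝕜)⁻¹‖ * ‖q‖ < 1 := by
  have hq0 : 0 < ‖q‖ := inv_pos.mp (lt_of_le_of_lt (norm_nonneg _) huq)
  have hu0 : 0 < ‖(u : 𝕜)‖ := norm_pos_iff.mpr u.ne_zero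
  rw [max_mul_of_nonneg _ _ hq0.le, max_lt_iff]
  constructor
  · calc ‖(u : 𝕜)‖ * ‖q‖ < ‖q‖⁻¹ * ‖q‖ := mul_lt_mul_of_pos_right huq hq0
      _ = 1 := inv_mul_cancel₀ hq0.ne'
  · rw [norm_inv]
    calc ‖(u : 𝕜)‖⁻¹ * ‖q‖ < ‖(u : 𝕜)‖⁻¹ * ‖(u : 𝕜)‖ := mul_lt_mul_of_pos_left hqu (inv_pos.mpr hu0)
      _ = 1 := inv_mul_cancel₀ hu0.ne'

/-- `‖q‖ < 1` on the annulus `‖q‖ < ‖u‖ < ‖q‖⁻¹`. [cite: SilvermanATAEC1994, Thm. V.3.1 (c) (proof, PDF p. 397)] -/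
theorem norm_lt_one_of_annulus' (hqu : ‖q‖ < ‖(u : 𝕜)‖) (huq : ‖(u : 𝕜)‖ < ‖q‖⁻¹) :
    ‖q‖ < 1 := by
  have h := max_mul_norm_lt_one u hqu huq
  have hM1 := one_le_max_norm u
  have hq0 : 0 ≤ ‖q‖ := norm_nonneg _
  nlinarith

/-- Comparison lemma: terms bounded by `C (d+1)^k r^{d+1}` (`0 ≤ r < 1`) give `EvSummable`.
[folklore] -/
private theorem evSummable_of_bound {Φ : LaurentQSeries} {C r : ℝ} {k : ℕ} (hr0 : 0 ≤ r)
    (hr : r < 1)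
    (hb : ∀ d : ℕ, ‖evTerm Φ u q (d + 1)‖ ≤ C * ((d + 1 : ℕ) : ℝ) ^ k * r ^ (d + 1)) :
    EvSummable Φ u q := by
  have hr' : ‖r‖ < 1 := by rwa [Real.norm_of_nonneg hr0]
  have hg : Summable fun n : ℕ ↦ (n : ℝ) ^ k * r ^ n := summable_pow_mul_geometric_of_norm_lt_one k hr'
  have hg' : Summable fun d : ℕ ↦ C * (((d + 1 : ℕ) : ℝ) ^ k * r ^ (d + 1)) :=
    ((summable_nat_add_iff 1).mpr hg).mul_left C
  rw [EvSummable, ← summable_nat_add_iff 1]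
  refine Summable.of_nonneg_of_le (fun _ ↦ norm_nonneg _) (fun d ↦ ?_) hg'
  rw [← mul_assoc]; exact hb d

/-- The terms of `X̃` at `(u, q)`, `d ≥ 1`: `(1−u)² c_d(u) q^{d+1}` (shape of `tateX_eq_annulus`).
[cite: SilvermanATAEC1994, Thm. V.3.1 (c) (proof, PDF p. 397)] -/
theorem evTerm_xForm_succ (d : ℕ) : evTerm xForm u q (d + 1) =
    (1 - (u : 𝕜)) ^ 2 * ((∑ m ∈ (d + 1).divisors, ((m : ℕ) : 𝕜) * ((u : 𝕜) ^ m + (u : 𝕜)⁻¹ ^ m - 2))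
      * q ^ (d + 1)) := by
  rw [evTerm, coeff_xForm_succ, map_mul, map_pow, map_sub, map_one, evCoeff_T, zpow_one,
    evCoeff_xCoeffL, mul_assoc]

/-- The constant term of `X̃` at `(u,q)` is `u`. [cite: SilvermanATAEC1994, Thm. V.3.1 (c) (proof, PDF p. 397)] -/
theorem evTerm_xForm_zero : evTerm xForm u q 0 = (u : 𝕜) := by
  rw [evTerm, coeff_xForm_zero, evCoeff_T, zpow_one, pow_zero, mul_one]

/-- The terms of `Ỹ` at `(u, q)`, `d ≥ 1` (shape of `tateY_eq_annulus`).
[cite: SilvermanATAEC1994, Thm. V.3.1 (c) (proof, PDF p. 397)] -/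
theorem evTerm_yForm_succ (d : ℕ) : evTerm yForm u q (d + 1) =
    (1 - (u : 𝕜)) ^ 3 * ((∑ m ∈ (d + 1).divisors, ((((m.choose 2 : ℕ)) : 𝕜) * (u : 𝕜) ^ m
      - (((m + 1).choose 2 : ℕ) : 𝕜) * (u : 𝕜)⁻¹ ^ m + (m : 𝕜))) * q ^ (d + 1)) := by
  rw [evTerm, coeff_yForm_succ, map_mul, map_pow, map_sub, map_one, evCoeff_T, zpow_one,
    evCoeff_yCoeffL, mul_assoc]

/-- The constant term of `Ỹ` at `(u,q)` is `u²`. [cite: SilvermanATAEC1994, Thm. V.3.1 (c) (proof, PDF p. 397)] -/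
theorem evTerm_yForm_zero : evTerm yForm u q 0 = (u : 𝕜) ^ 2 := by
  rw [evTerm, coeff_yForm_zero, evCoeff_T, pow_zero, mul_one,
    show (2 : ℤ) = ((2 : ℕ) : ℤ) from rfl, zpow_natCast, Units.val_pow_eq_pow_val]

/-- `X̃` converges absolutely on the annulus `‖q‖ < ‖u‖ < ‖q‖⁻¹`.
[cite: SilvermanATAEC1994, Thm. V.3.1 (c) (proof, PDF p. 397)] -/
theorem evSummable_xForm (hqu : ‖q‖ < ‖(u : 𝕜)‖) (huq : ‖(u : 𝕜)‖ < ‖q‖⁻¹) :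
    EvSummable xForm u q := by
  set M := max ‖(u : 𝕜)‖ ‖(u : 𝕜)⁻¹‖ with hM
  have hMq := max_mul_norm_lt_one u hqu huq
  have hM0 : 0 ≤ M := le_max_of_le_left (norm_nonneg _)
  refine evSummable_of_bound u (mul_nonneg hM0 (norm_nonneg _)) hMq
    (C := ‖1 - (u : 𝕜)‖ ^ 2 * 4) (k := 2) fun d ↦ ?_
  rw [evTerm_xForm_succ]
  simp only [norm_mul, norm_pow]
  have h := norm_evCoeff_xCoeffL_le u d
  rw [evCoeff_xCoeffL] at h
  calc ‖1 - (u : 𝕜)‖ ^ 2 * (‖∑ m ∈ (d + 1).divisors, ((m : ℕ) : 𝕜) * ((u : 𝕜) ^ m + (u : 𝕜)⁻¹ ^ m - 2)‖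
        * ‖q‖ ^ (d + 1)) ≤ ‖1 - (u : 𝕜)‖ ^ 2 * ((4 * ((d + 1 : ℕ) : ℝ) ^ 2 * M ^ (d + 1)) * ‖q‖ ^ (d + 1)) := by
        gcongr
    _ = ‖1 - (u : 𝕜)‖ ^ 2 * 4 * ((d + 1 : ℕ) : ℝ) ^ 2 * (M * ‖q‖) ^ (d + 1) := by rw [mul_pow]; ring

/-- `Ỹ` converges absolutely on the annulus `‖q‖ < ‖u‖ < ‖q‖⁻¹`.
[cite: SilvermanATAEC1994, Thm. V.3.1 (c) (proof, PDF p. 397)] -/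
theorem evSummable_yForm (hqu : ‖q‖ < ‖(u : 𝕜)‖) (huq : ‖(u : 𝕜)‖ < ‖q‖⁻¹) :
    EvSummable yForm u q := by
  set M := max ‖(u : 𝕜)‖ ‖(u : 𝕜)⁻¹‖ with hM
  have hMq := max_mul_norm_lt_one u hqu huq
  have hM0 : 0 ≤ M := le_max_of_le_left (norm_nonneg _)
  refine evSummable_of_bound u (mul_nonneg hM0 (norm_nonneg _)) hMq
    (C := ‖1 - (u : 𝕜)‖ ^ 3 * 3) (k := 3) fun d ↦ ?_
  rw [evTerm_yForm_succ]
  simp only [norm_mul, norm_pow]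
  have h := norm_evCoeff_yCoeffL_le u d
  rw [evCoeff_yCoeffL] at h
  calc ‖1 - (u : 𝕜)‖ ^ 3 * (‖∑ m ∈ (d + 1).divisors, ((((m.choose 2 : ℕ)) : 𝕜) * (u : 𝕜) ^ m
      - (((m + 1).choose 2 : ℕ) : 𝕜) * (u : 𝕜)⁻¹ ^ m + (m : 𝕜))‖ * ‖q‖ ^ (d + 1))
        ≤ ‖1 - (u : 𝕜)‖ ^ 3 * ((3 * ((d + 1 : ℕ) : ℝ) ^ 3 * M ^ (d + 1)) * ‖q‖ ^ (d + 1)) := by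
        gcongr
    _ = ‖1 - (u : 𝕜)‖ ^ 3 * 3 * ((d + 1 : ℕ) : ℝ) ^ 3 * (M * ‖q‖) ^ (d + 1) := by rw [mul_pow]; ring

/-- `a₄(q)` converges absolutely for `‖q‖ < 1`. [cite: SilvermanATAEC1994, Thm. V.3.1 (a) (PDF p. 395)] -/
theorem evSummable_a4Form (hq : ‖q‖ < 1) : EvSummable a4Form u q := by
  refine evSummable_of_bound u (norm_nonneg q) hq (C := 5) (k := 4) fun d ↦ ?_
  rw [evTerm, coeff_a4Form_succ, evCoeff_C, Int.cast_mul, Int.cast_neg, Int.cast_natCast,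
    Int.cast_ofNat]
  simp only [norm_mul, norm_neg, norm_pow]
  have hs : ‖((σ 3 (d + 1) : ℕ) : 𝕜)‖ ≤ ((d + 1 : ℕ) : ℝ) ^ 4 :=
    (norm_natCast_le' _).trans (by exact_mod_cast ArithmeticFunction.sigma_le_pow_succ 3 (d + 1))
  have h5 : ‖(5 : 𝕜)‖ ≤ 5 := norm_natCast_le' (𝕜 := 𝕜) 5
  calc ‖(5 : 𝕜)‖ * ‖((σ 3 (d + 1) : ℕ) : 𝕜)‖ * ‖q‖ ^ (d + 1)
      ≤ 5 * ((d + 1 : ℕ) : ℝ) ^ 4 * ‖q‖ ^ (d + 1) := by gcongr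

/-- `a₆(q)` converges absolutely for `‖q‖ < 1`. [cite: SilvermanATAEC1994, Thm. V.3.1 (a) (PDF p. 395)] -/
theorem evSummable_a6Form (hq : ‖q‖ < 1) : EvSummable a6Form u q := by
  refine evSummable_of_bound u (norm_nonneg q) hq (C := 12) (k := 6) fun d ↦ ?_
  rw [evTerm, coeff_a6Form_succ, evCoeff_C, Int.cast_neg]
  simp only [norm_mul, norm_neg, norm_pow]
  have hz := twelve_mul_a6Coeff (d + 1)
  have hnn : 0 ≤ a6Coeff (d + 1) := by
    have : 0 ≤ 12 * a6Coeff (d + 1) := by rw [hz]; positivity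
    omega
  have hcast : (((a6Coeff (d + 1)).toNat : ℕ) : ℤ) = a6Coeff (d + 1) := Int.toNat_of_nonneg hnn
  have e : (a6Coeff (d + 1) : 𝕜) = (((a6Coeff (d + 1)).toNat : ℕ) : 𝕜) := by
    rw [← Int.cast_natCast, hcast]
  have hle : ‖(a6Coeff (d + 1) : 𝕜)‖ ≤ 12 * ((d + 1 : ℕ) : ℝ) ^ 6 := by
    rw [e]
    have hR : (((a6Coeff (d + 1)).toNat : ℕ) : ℝ) = ((a6Coeff (d + 1) : ℤ) : ℝ) := by
      exact_mod_cast hcast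
    have s3 : ((σ 3 (d + 1) : ℕ) : ℝ) ≤ ((d + 1 : ℕ) : ℝ) ^ 4 := by
      exact_mod_cast ArithmeticFunction.sigma_le_pow_succ 3 (d + 1)
    have s5 : ((σ 5 (d + 1) : ℕ) : ℝ) ≤ ((d + 1 : ℕ) : ℝ) ^ 6 := by
      exact_mod_cast ArithmeticFunction.sigma_le_pow_succ 5 (d + 1)
    have h46 : ((d + 1 : ℕ) : ℝ) ^ 4 ≤ ((d + 1 : ℕ) : ℝ) ^ 6 :=
      pow_le_pow_right₀ (by exact_mod_cast Nat.succ_le_succ (Nat.zero_le d)) (by norm_num)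
    have hzR : 12 * ((a6Coeff (d + 1) : ℤ) : ℝ) = 5 * ((σ 3 (d + 1) : ℕ) : ℝ) + 7 * ((σ 5 (d + 1) : ℕ) : ℝ) := by
      exact_mod_cast hz
    have hnnR : (0 : ℝ) ≤ ((a6Coeff (d + 1) : ℤ) : ℝ) := by exact_mod_cast hnn
    calc ‖(((a6Coeff (d + 1)).toNat : ℕ) : 𝕜)‖ ≤ ((a6Coeff (d + 1)).toNat : ℕ) := norm_natCast_le' _
      _ = ((a6Coeff (d + 1) : ℤ) : ℝ) := hR
      _ ≤ 12 * ((d + 1 : ℕ) : ℝ) ^ 6 := by nlinarith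
  calc ‖(a6Coeff (d + 1) : 𝕜)‖ * ‖q‖ ^ (d + 1) ≤ 12 * ((d + 1 : ℕ) : ℝ) ^ 6 * ‖q‖ ^ (d + 1) := by
        gcongr

end Eval

end Literature.NumberTheory.EllipticCurves.TateCurve

end
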